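import Literature.NumberTheory.Sieve.DrappeauDispersionMainKernelLiouville
import Literature.NumberTheory.Sieve.DrappeauDispersionLemmas
import Literature.NumberTheory.Sieve.LiouvilleCharacterMeanValue
import Literature.NumberTheory.LFunctions.DirichletCharacterCRTProd
import HarnessLib

/-!
# Twisted Liouville sums over a residue class: `g`-extraction, character expansion, hybrid families

Topic `Literature/NumberTheory/Sieve`; theorems only, everything PROVED.  The class sums
`∑_{t ≤ M, dt ≡ e (L)} λ(t) ψ(t)` produced by `DrappeauDispersionMainKernelLiouville.lean` (twist `ψ` = a
primitive character mod `f`, `(f, L) = 1`, unit multiplier `d`) are reduced to the objects of the mean value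
theorem `LiouvilleMV.sum_lmvTerm_le` (`LiouvilleCharacterMeanValue.lean`):

* `classSum_eq_gcd_extract` — **`g`-extraction**: with `g = (e, L)`, `L' = L/g`, `e' = e/g` (a unit mod `L'`),
  `∑_{t ≤ M, dt ≡ e (L)} λ(t)ψ(t) = λ(g)ψ(g) ∑_{t' ≤ M/g, dt' ≡ e' (L')} λ(t')ψ(t')` (`t = g t'`; complete
  multiplicativity), and the norm version `norm_classSum_le_gcd_extract`;
* `norm_classSum_le_sum_primIndex` — **character expansion of a unit class and reduction to primitive
  characters**: for `e'` and `d` units mod `L'` and `(f, L') = 1`,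
  `‖∑_{t ≤ M', dt ≡ e' (L')} λ(t)ψ(t)‖ ≤ φ(L')⁻¹ ∑_{(L'',ξ*) ∈ S(L')} ‖Λ_{L'}(M', ψ ⊗ ξ*)‖`, where
  `Λ_r(X, χ) = ∑_{n ≤ X, (n,r)=1} λ(n)χ(n)` (`LiouvilleMV.liouvilleCharSum`) and `ψ ⊗ ξ*` is the product character
  mod `f L''` (`Literature.NumberTheory.LFunctions.crtProd`, primitive when both factors are);
* `sum_inv_totient_mul_sum_Lsup_crtProd_le` — **the hybrid family in one dyadic block**: for `L'' ∣ L'` and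
  `F ≥ 1`, `∑_{F < f ≤ 2F, (f,L'')=1} φ(f)⁻¹ ∑*_{ψ mod f} ∑*_{ξ mod L''} Λ*_{L'}(H; ψ ⊗ ξ) ≤ (φ(L'')/(F L''))
  ∑_{k ≤ 2FL''} b_{L'}(H; k)` (`Lsup`, `lmvTerm`; injectivity and primitivity of `(ψ, ξ) ↦ ψ ⊗ ξ`,
  `φ(fL'') = φ(f)φ(L'')`).

Consumer: stub `stub_mainTerms` of the crux `TypeI2Dilated` (line `peel-to-drappeau`,
`Summits/Parity/GeneralizedHardyLittlewood/Theses/LiouvilleShiftedTables.lean`).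

## References

* S. Drappeau, Proc. London Math. Soc. (3) 114 (2017), §6 (treatment of `𝒮₁⁻`). [Drappeau2017]
* H. Iwaniec, E. Kowalski, *Analytic Number Theory*, AMS 2004, §17.1 (reduction to primitive characters).
  [IwaniecKowalski2004]
-/

noncomputable section

open Finset Real Complex

namespace Literature.NumberTheory.Sieve

namespace Drappeau2017

open VaughanMoebius BVMoebius ArithmeticFunction LiouvilleMV
open Literature.NumberTheory.LFunctions (crtProd crtProd_apply_natCast crtProd_injective isPrimitive_crtProd)
open scoped ArithmeticFunction.Moebius Classical

/-! ### `g`-extraction -/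

/-- The class `{t ≤ M : d t ≡ e (mod L)}` for `(d, L) = 1` is `g · {t' ≤ M/g : d t' ≡ e/g (mod L/g)}`,
`g = (e, L)`. [folklore] -/
theorem filter_mul_natCast_eq_eq_image {L : ℕ} (hL : 0 < L) {d : ℕ} (hd : d.Coprime L) (e M : ℕ) :
    (Icc 1 M).filter (fun t : ℕ => ((d * t : ℕ) : ZMod L) = (e : ZMod L)) =
      ((Icc 1 (M / Nat.gcd e L)).filter (fun t' : ℕ =>
        ((d * t' : ℕ) : ZMod (L / Nat.gcd e L)) = ((e / Nat.gcd e L : ℕ) : ZMod (L / Nat.gcd e L)))).image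
        (fun t' => Nat.gcd e L * t') := by
  set g := Nat.gcd e L with hg
  have hg0 : 0 < g := Nat.gcd_pos_of_pos_right _ hL
  have hdg : d.Coprime g := Nat.Coprime.coprime_dvd_right (Nat.gcd_dvd_right e L) hd
  ext t
  simp only [mem_filter, mem_Icc, mem_image]
  constructor
  · rintro ⟨⟨ht1, htM⟩, hcls⟩
    rw [natCast_eq_iff_gcd_dvd hL] at hcls
    obtain ⟨hgdt, hcls'⟩ := hcls
    have hgt : g ∣ t := (Nat.Coprime.dvd_mul_left hdg.symm).1 hgdt
    obtain ⟨t', rfl⟩ := hgt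
    refine ⟨t', ⟨⟨?_, ?_⟩, ?_⟩, rfl⟩
    · rcases Nat.eq_zero_or_pos t' with h | h
      · subst h; simp at ht1
      · exact h
    · exact (Nat.le_div_iff_mul_le hg0).2 (by rw [mul_comm]; exact htM)
    · rwa [← hg, show d * (g * t') / g = d * t' by
        rw [mul_left_comm, Nat.mul_div_cancel_left _ hg0]] at hcls'
  · rintro ⟨t', ⟨⟨ht'1, ht'M⟩, hcls'⟩, rfl⟩
    refine ⟨⟨Nat.mul_pos hg0 ht'1, ?_⟩, ?_⟩
    · have := (Nat.le_div_iff_mul_le hg0).1 ht'M; rw [mul_comm] at this; exact this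
    · rw [natCast_eq_iff_gcd_dvd hL, ← hg]
      refine ⟨dvd_mul_of_dvd_right (dvd_mul_right g t') d, ?_⟩
      rwa [show d * (g * t') / g = d * t' by rw [mul_left_comm, Nat.mul_div_cancel_left _ hg0]]

/-- **`g`-extraction.**  For `(d, L) = 1`, `L ≥ 1`, `g = (e, L)`:
`∑_{t ≤ M, dt ≡ e (L)} λ(t)ψ(t) = λ(g)ψ(g) · ∑_{t' ≤ M/g, dt' ≡ e/g (L/g)} λ(t')ψ(t')`. [folklore] -/
theorem classSum_eq_gcd_extract {L : ℕ} (hL : 0 < L) {d : ℕ} (hd : d.Coprime L) (e M : ℕ) {f : ℕ}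
    (ψ : DirichletCharacter ℂ f) :
    ∑ t ∈ (Icc 1 M).filter (fun t : ℕ => ((d * t : ℕ) : ZMod L) = (e : ZMod L)),
        ((liouville t : ℤ) : ℂ) * ψ (t : ZMod f) =
      (((liouville (Nat.gcd e L) : ℤ) : ℂ) * ψ ((Nat.gcd e L : ℕ) : ZMod f)) *
        ∑ t' ∈ (Icc 1 (M / Nat.gcd e L)).filter (fun t' : ℕ =>
            ((d * t' : ℕ) : ZMod (L / Nat.gcd e L)) = ((e / Nat.gcd e L : ℕ) : ZMod (L / Nat.gcd e L))),
          ((liouville t' : ℤ) : ℂ) * ψ (t' : ZMod f) := by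
  have hg0 : 0 < Nat.gcd e L := Nat.gcd_pos_of_pos_right _ hL
  rw [filter_mul_natCast_eq_eq_image hL hd e M,
    sum_image fun x _ y _ h => Nat.eq_of_mul_eq_mul_left hg0 h, mul_sum]
  refine sum_congr rfl fun t' _ => ?_
  rw [liouville_char_mul]

/-- Norm form of the `g`-extraction: `‖∑_{t ≤ M, dt ≡ e (L)} λψ‖ ≤ ‖∑_{t' ≤ M/g, dt' ≡ e/g (L/g)} λψ‖`. [folklore] -/
theorem norm_classSum_le_gcd_extract {L : ℕ} (hL : 0 < L) {d : ℕ} (hd : d.Coprime L) (e M : ℕ) {f : ℕ}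
    (ψ : DirichletCharacter ℂ f) :
    ‖∑ t ∈ (Icc 1 M).filter (fun t : ℕ => ((d * t : ℕ) : ZMod L) = (e : ZMod L)),
        ((liouville t : ℤ) : ℂ) * ψ (t : ZMod f)‖ ≤
      ‖∑ t' ∈ (Icc 1 (M / Nat.gcd e L)).filter (fun t' : ℕ =>
            ((d * t' : ℕ) : ZMod (L / Nat.gcd e L)) = ((e / Nat.gcd e L : ℕ) : ZMod (L / Nat.gcd e L))),
          ((liouville t' : ℤ) : ℂ) * ψ (t' : ZMod f)‖ := by
  rw [classSum_eq_gcd_extract hL hd e M ψ, norm_mul]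
  exact mul_le_of_le_one_left (norm_nonneg _) (norm_liouville_mul_char_le ψ _)

/-! ### Character expansion of a unit class and reduction to primitive characters -/

/-- **Character expansion + primitive reduction.**  Let `L' ≥ 1`, `e'` and `d` coprime to `L'`, `f ≥ 1` with
`(f, L') = 1`, `ψ` a character mod `f`.  Then
`‖∑_{t ≤ M, dt ≡ e' (L')} λ(t)ψ(t)‖ ≤ φ(L')⁻¹ ∑_{(L'',ξ*) ∈ S(L')} ‖Λ_{L'}(M, ψ ⊗ ξ*)‖`.
[cite: IwaniecKowalski2004, §17.1] -/
theorem norm_classSum_le_sum_primIndex {L' : ℕ} (hL' : 0 < L') {e' d : ℕ} (he' : e'.Coprime L')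
    (hd : d.Coprime L') {f : ℕ} (hf : 0 < f) (ψ : DirichletCharacter ℂ f) (M : ℕ) :
    ‖∑ t ∈ (Icc 1 M).filter (fun t : ℕ => ((d * t : ℕ) : ZMod L') = (e' : ZMod L')),
        ((liouville t : ℤ) : ℂ) * ψ (t : ZMod f)‖ ≤
      ((Nat.totient L' : ℝ))⁻¹ *
        ∑ p' ∈ primIndex L', ‖liouvilleCharSum L' (crtProd ψ p'.2) M‖ := by
  haveI : NeZero L' := ⟨hL'.ne'⟩
  haveI : NeZero f := ⟨hf.ne'⟩
  have hφ : (0 : ℝ) < Nat.totient L' := by exact_mod_cast Nat.totient_pos.2 hL'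
  -- the class as a unit `a₀ mod L'`
  have hdu : IsUnit (d : ZMod L') := (ZMod.isUnit_iff_coprime d L').2 hd
  have heu : IsUnit (e' : ZMod L') := (ZMod.isUnit_iff_coprime e' L').2 he'
  set a : ZMod L' := (e' : ZMod L') * ((d : ZMod L'))⁻¹ with hadef
  have hdinv : IsUnit ((d : ZMod L'))⁻¹ := IsUnit.of_mul_eq_one (d : ZMod L') (ZMod.inv_mul_of_unit _ hdu)
  have hau : IsUnit a := heu.mul hdinv
  set a₀ : ℕ := a.val with ha₀def
  have ha₀ : (a₀ : ZMod L') = a := by rw [ha₀def, ZMod.natCast_zmod_val]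
  have ha₀c : a₀.Coprime L' := (ZMod.isUnit_iff_coprime a₀ L').1 (ha₀ ▸ hau)
  have hcls : ∀ t : ℕ, (((d * t : ℕ) : ZMod L') = (e' : ZMod L')) ↔ ((t : ZMod L') = (a₀ : ZMod L')) := by
    intro t
    rw [ha₀, hadef, Nat.cast_mul]
    constructor
    · intro h
      rw [← h, mul_comm ((d : ZMod L')) (t : ZMod L'), mul_assoc, ZMod.mul_inv_of_unit _ hdu, mul_one]
    · intro h
      rw [h, mul_comm, mul_assoc, ZMod.inv_mul_of_unit _ hdu, mul_one]
  -- expand the indicator into characters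
  have hexp : ∑ t ∈ (Icc 1 M).filter (fun t : ℕ => ((d * t : ℕ) : ZMod L') = (e' : ZMod L')),
      ((liouville t : ℤ) : ℂ) * ψ (t : ZMod f) =
      ((Nat.totient L' : ℂ))⁻¹ * ∑ ξ : DirichletCharacter ℂ L',
        ξ ((a₀ : ZMod L'))⁻¹ * ∑ t ∈ Icc 1 M, ((liouville t : ℤ) : ℂ) * ψ (t : ZMod f) * ξ (t : ZMod L') := by
    rw [filter_congr fun t _ => hcls t, sum_filter]
    calc ∑ t ∈ Icc 1 M, (if (t : ZMod L') = (a₀ : ZMod L') then ((liouville t : ℤ) : ℂ) * ψ (t : ZMod f) else 0)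
        = ∑ t ∈ Icc 1 M, (if (t : ZMod L') = (a₀ : ZMod L') then (1 : ℂ) else 0) *
            (((liouville t : ℤ) : ℂ) * ψ (t : ZMod f)) := by
          refine sum_congr rfl fun t _ => ?_; split_ifs <;> simp
      _ = ∑ t ∈ Icc 1 M, (((Nat.totient L' : ℂ))⁻¹ * ∑ ξ : DirichletCharacter ℂ L',
            ξ ((a₀ : ZMod L'))⁻¹ * ξ (t : ZMod L')) * (((liouville t : ℤ) : ℂ) * ψ (t : ZMod f)) := by
          refine sum_congr rfl fun t _ => ?_
          rw [indicator_eq_sum_char hL' ha₀c t]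
      _ = ∑ t ∈ Icc 1 M, ∑ ξ : DirichletCharacter ℂ L', ((Nat.totient L' : ℂ))⁻¹ *
            (ξ ((a₀ : ZMod L'))⁻¹ * (((liouville t : ℤ) : ℂ) * ψ (t : ZMod f) * ξ (t : ZMod L'))) := by
          refine sum_congr rfl fun t _ => ?_
          rw [mul_sum, sum_mul]
          refine sum_congr rfl fun ξ _ => ?_
          ring
      _ = ∑ ξ : DirichletCharacter ℂ L', ∑ t ∈ Icc 1 M, ((Nat.totient L' : ℂ))⁻¹ *
            (ξ ((a₀ : ZMod L'))⁻¹ * (((liouville t : ℤ) : ℂ) * ψ (t : ZMod f) * ξ (t : ZMod L'))) :=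
          sum_comm
      _ = _ := by
          rw [mul_sum]
          refine sum_congr rfl fun ξ _ => ?_
          rw [mul_sum, mul_sum]
  rw [hexp, norm_mul, norm_inv, Complex.norm_natCast]
  refine mul_le_mul_of_nonneg_left ?_ (inv_nonneg.2 hφ.le)
  -- character by character, then to primitive characters
  calc ‖∑ ξ : DirichletCharacter ℂ L', ξ ((a₀ : ZMod L'))⁻¹ *
          ∑ t ∈ Icc 1 M, ((liouville t : ℤ) : ℂ) * ψ (t : ZMod f) * ξ (t : ZMod L')‖
      ≤ ∑ ξ : DirichletCharacter ℂ L', ‖ξ ((a₀ : ZMod L'))⁻¹ *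
          ∑ t ∈ Icc 1 M, ((liouville t : ℤ) : ℂ) * ψ (t : ZMod f) * ξ (t : ZMod L')‖ := norm_sum_le _ _
    _ ≤ ∑ ξ : DirichletCharacter ℂ L',
          ‖∑ t ∈ Icc 1 M, ((liouville t : ℤ) : ℂ) * ψ (t : ZMod f) * ξ (t : ZMod L')‖ := by
        refine sum_le_sum fun ξ _ => ?_
        rw [norm_mul]
        exact mul_le_of_le_one_left (norm_nonneg _) (ξ.norm_le_one _)
    _ ≤ ∑ p' ∈ primIndex L',
          ‖∑ t ∈ Icc 1 M, ((liouville t : ℤ) : ℂ) * ψ (t : ZMod f) * (induce L' p') (t : ZMod L')‖ :=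
        sum_le_sum_primIndex L' fun ξ => norm_nonneg _
    _ = ∑ p' ∈ primIndex L', ‖liouvilleCharSum L' (crtProd ψ p'.2) M‖ := by
        refine sum_congr rfl fun p' hp' => ?_
        obtain ⟨hp's, -, -⟩ := mem_primIndex.1 hp'
        haveI : NeZero p'.1 := ⟨fun h => hL'.ne' (Nat.eq_zero_of_zero_dvd (h ▸ hp's))⟩
        congr 1
        rw [liouvilleCharSum, show Ioc 0 M = Icc 1 M from rfl]
        refine sum_congr rfl fun t _ => ?_
        rw [induce, dif_pos hp's, changeLevel_apply_natCast hp's, copChar_div_eq_copChar hL'.ne' hp's]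
        unfold copChar
        split_ifs with h
        · rw [crtProd_apply_natCast, mul_assoc]
        · simp

/-! ### The hybrid family in one dyadic block -/

/-- For coprime `f, L'' ≥ 1`: the map `(ψ, ξ) ↦ ψ ⊗ ξ` sends pairs of primitive characters injectively to
primitive characters mod `f L''`, so a nonnegative function summed over the pairs is at most its sum over all
primitive characters mod `f L''`. [cite: IwaniecKowalski2004, §17.1] -/
theorem sum_sum_crtProd_le_sum_primitive {f L'' : ℕ} (hf : 0 < f) (hL'' : 0 < L'') (hcop : f.Coprime L'')
    {G : DirichletCharacter ℂ (f * L'') → ℝ} (hG : ∀ χ, 0 ≤ G χ) :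
    ∑ ψ ∈ (univ : Finset (DirichletCharacter ℂ f)).filter DirichletCharacter.IsPrimitive,
      ∑ ξ ∈ (univ : Finset (DirichletCharacter ℂ L'')).filter DirichletCharacter.IsPrimitive, G (crtProd ψ ξ) ≤
      ∑ χ ∈ (univ : Finset (DirichletCharacter ℂ (f * L''))).filter DirichletCharacter.IsPrimitive, G χ := by
  haveI : NeZero f := ⟨hf.ne'⟩
  haveI : NeZero L'' := ⟨hL''.ne'⟩
  set A := (univ : Finset (DirichletCharacter ℂ f)).filter DirichletCharacter.IsPrimitive with hA
  set B := (univ : Finset (DirichletCharacter ℂ L'')).filter DirichletCharacter.IsPrimitive with hB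
  have hinj : Set.InjOn (fun p : DirichletCharacter ℂ f × DirichletCharacter ℂ L'' => crtProd p.1 p.2)
      ↑(A ×ˢ B) := by
    rintro ⟨ψ, ξ⟩ _ ⟨ψ', ξ'⟩ _ h
    obtain ⟨h1, h2⟩ := crtProd_injective hcop h
    exact Prod.ext h1 h2
  rw [← sum_product' (f := fun ψ ξ => G (crtProd ψ ξ)), ← sum_image hinj]
  refine sum_le_sum_of_subset_of_nonneg ?_ fun χ _ _ => hG χ
  intro χ hχ
  rw [mem_image] at hχ
  obtain ⟨⟨ψ, ξ⟩, hmem, rfl⟩ := hχ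
  rw [mem_product, hA, hB, mem_filter, mem_filter] at hmem
  exact mem_filter.2 ⟨mem_univ _, isPrimitive_crtProd hcop hmem.1.2 hmem.2.2⟩

/-- **One dyadic block of the hybrid family.**  For `L' ≥ 1`, a divisor-free parameter `L'' ≥ 1` (the conductor
of the `ξ*`), `F ≥ 1` and a height `H`:
`∑_{F < f ≤ 2F, (f, L'') = 1} φ(f)⁻¹ ∑*_{ψ mod f} ∑*_{ξ mod L''} Λ*_{L'}(H; ψ ⊗ ξ) ≤ (φ(L'')/(F L'')) ∑_{k ≤ 2FL''} b_{L'}(H; k)`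
(`LiouvilleMV.Lsup`, `LiouvilleMV.lmvTerm`): `φ(f)⁻¹ = (φ(L'')/(f L''))·(fL''/φ(fL''))`, `f > F`, and the previous
lemma. [cite: IwaniecKowalski2004, §17.1] -/
theorem sum_inv_totient_mul_sum_Lsup_crtProd_le (L' : ℕ) {L'' : ℕ} (hL'' : 0 < L'') {F : ℕ} (hF : 0 < F)
    (H : ℝ) :
    ∑ f ∈ (Ioc F (2 * F)).filter (fun f => f.Coprime L''), ((Nat.totient f : ℝ))⁻¹ *
        ∑ ψ ∈ (univ : Finset (DirichletCharacter ℂ f)).filter DirichletCharacter.IsPrimitive,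
          ∑ ξ ∈ (univ : Finset (DirichletCharacter ℂ L'')).filter DirichletCharacter.IsPrimitive,
            Lsup L' (crtProd ψ ξ) H ≤
      ((Nat.totient L'' : ℝ) / (F * L'')) * ∑ k ∈ Icc 1 (2 * F * L''), lmvTerm L' H k := by
  have hL''0 : (0 : ℝ) < L'' := by exact_mod_cast hL''
  have hF0 : (0 : ℝ) < F := by exact_mod_cast hF
  have hφL'' : (0 : ℝ) < Nat.totient L'' := by exact_mod_cast Nat.totient_pos.2 hL''
  -- termwise: `φ(f)⁻¹ ΣΣ ≤ (φ(L'')/(F L'')) · lmvTerm (f L'')`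
  have hterm : ∀ f ∈ (Ioc F (2 * F)).filter (fun f => f.Coprime L''),
      ((Nat.totient f : ℝ))⁻¹ *
        ∑ ψ ∈ (univ : Finset (DirichletCharacter ℂ f)).filter DirichletCharacter.IsPrimitive,
          ∑ ξ ∈ (univ : Finset (DirichletCharacter ℂ L'')).filter DirichletCharacter.IsPrimitive,
            Lsup L' (crtProd ψ ξ) H ≤
      ((Nat.totient L'' : ℝ) / (F * L'')) * lmvTerm L' H (f * L'') := by
    intro f hf
    rw [mem_filter, mem_Ioc] at hf
    obtain ⟨⟨hFf, hf2F⟩, hcop⟩ := hf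
    have hf0 : 0 < f := lt_of_le_of_lt (Nat.zero_le F) hFf
    have hf0' : (0 : ℝ) < f := by exact_mod_cast hf0
    have hφf : (0 : ℝ) < Nat.totient f := by exact_mod_cast Nat.totient_pos.2 hf0
    have hφmul : (Nat.totient (f * L'') : ℝ) = Nat.totient f * Nat.totient L'' := by
      rw [Nat.totient_mul hcop]; push_cast; ring
    have hS := sum_sum_crtProd_le_sum_primitive hf0 hL'' hcop (G := fun χ => Lsup L' χ H)
      (fun χ => Lsup_nonneg L' χ H)
    have hSnn : 0 ≤ ∑ χ ∈ (univ : Finset (DirichletCharacter ℂ (f * L''))).filter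
        DirichletCharacter.IsPrimitive, Lsup L' χ H := sum_nonneg fun χ _ => Lsup_nonneg L' χ H
    -- `φ(f)⁻¹ ≤ (φ(L'')/(F L'')) · (fL''/φ(fL''))`
    have hcoef : ((Nat.totient f : ℝ))⁻¹ ≤
        ((Nat.totient L'' : ℝ) / (F * L'')) * (((f * L'' : ℕ) : ℝ) / Nat.totient (f * L'')) := by
      rw [hφmul, Nat.cast_mul]
      rw [show ((Nat.totient L'' : ℝ) / (F * L'')) * ((f : ℝ) * L'' / (Nat.totient f * Nat.totient L'')) =
        ((f : ℝ) / F) * ((Nat.totient f : ℝ))⁻¹ by field_simp]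
      have hfF : (1 : ℝ) ≤ (f : ℝ) / F := by
        rw [le_div_iff₀ hF0, one_mul]; exact_mod_cast hFf.le
      calc ((Nat.totient f : ℝ))⁻¹ = 1 * ((Nat.totient f : ℝ))⁻¹ := (one_mul _).symm
        _ ≤ ((f : ℝ) / F) * ((Nat.totient f : ℝ))⁻¹ :=
            mul_le_mul_of_nonneg_right hfF (inv_nonneg.2 hφf.le)
    calc ((Nat.totient f : ℝ))⁻¹ *
          ∑ ψ ∈ (univ : Finset (DirichletCharacter ℂ f)).filter DirichletCharacter.IsPrimitive,
            ∑ ξ ∈ (univ : Finset (DirichletCharacter ℂ L'')).filter DirichletCharacter.IsPrimitive,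
              Lsup L' (crtProd ψ ξ) H
        ≤ ((Nat.totient f : ℝ))⁻¹ * ∑ χ ∈ (univ : Finset (DirichletCharacter ℂ (f * L''))).filter
            DirichletCharacter.IsPrimitive, Lsup L' χ H :=
          mul_le_mul_of_nonneg_left hS (inv_nonneg.2 hφf.le)
      _ ≤ (((Nat.totient L'' : ℝ) / (F * L'')) * (((f * L'' : ℕ) : ℝ) / Nat.totient (f * L''))) *
            ∑ χ ∈ (univ : Finset (DirichletCharacter ℂ (f * L''))).filter
              DirichletCharacter.IsPrimitive, Lsup L' χ H :=
          mul_le_mul_of_nonneg_right hcoef hSnn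
      _ = ((Nat.totient L'' : ℝ) / (F * L'')) * lmvTerm L' H (f * L'') := by
          rw [lmvTerm, mul_assoc]
  refine (sum_le_sum hterm).trans ?_
  rw [← mul_sum]
  refine mul_le_mul_of_nonneg_left ?_ (by positivity)
  -- `∑_{F < f ≤ 2F, (f,L'')=1} b(fL'') ≤ ∑_{k ≤ 2FL''} b(k)` (injective `f ↦ fL''`, nonnegative terms)
  have hinj : Set.InjOn (fun f : ℕ => f * L'') ↑((Ioc F (2 * F)).filter (fun f => f.Coprime L'')) := by
    intro f _ f' _ h
    exact Nat.eq_of_mul_eq_mul_right hL'' h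
  rw [← sum_image hinj]
  refine sum_le_sum_of_subset_of_nonneg ?_ fun k _ _ => lmvTerm_nonneg L' H k
  intro k hk
  rw [mem_image] at hk
  obtain ⟨f, hf, rfl⟩ := hk
  rw [mem_filter, mem_Ioc] at hf
  exact mem_Icc.2 ⟨Nat.mul_pos (lt_of_le_of_lt (Nat.zero_le F) hf.1.1) hL'',
    Nat.mul_le_mul_right L'' hf.1.2⟩

/-- **A range of the hybrid family** (the previous lemma with an arbitrary upper endpoint `F'` in place of
`2F`): `∑_{F < f ≤ F', (f, L'') = 1} φ(f)⁻¹ ∑*_{ψ mod f} ∑*_{ξ mod L''} Λ*_{L'}(H; ψ ⊗ ξ) ≤ (φ(L'')/(F L'')) ∑_{k ≤ F'L''} b_{L'}(H; k)`.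
[cite: IwaniecKowalski2004, §17.1] -/
theorem sum_Ioc_inv_totient_mul_sum_Lsup_crtProd_le (L' : ℕ) {L'' : ℕ} (hL'' : 0 < L'') {F : ℕ} (hF : 0 < F)
    (F' : ℕ) (H : ℝ) :
    ∑ f ∈ (Ioc F F').filter (fun f => f.Coprime L''), ((Nat.totient f : ℝ))⁻¹ *
        ∑ ψ ∈ (univ : Finset (DirichletCharacter ℂ f)).filter DirichletCharacter.IsPrimitive,
          ∑ ξ ∈ (univ : Finset (DirichletCharacter ℂ L'')).filter DirichletCharacter.IsPrimitive,
            Lsup L' (crtProd ψ ξ) H ≤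
      ((Nat.totient L'' : ℝ) / (F * L'')) * ∑ k ∈ Icc 1 (F' * L''), lmvTerm L' H k := by
  have hL''0 : (0 : ℝ) < L'' := by exact_mod_cast hL''
  have hF0 : (0 : ℝ) < F := by exact_mod_cast hF
  have hφL'' : (0 : ℝ) < Nat.totient L'' := by exact_mod_cast Nat.totient_pos.2 hL''
  -- termwise: `φ(f)⁻¹ ΣΣ ≤ (φ(L'')/(F L'')) · lmvTerm (f L'')`
  have hterm : ∀ f ∈ (Ioc F F').filter (fun f => f.Coprime L''),
      ((Nat.totient f : ℝ))⁻¹ *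
        ∑ ψ ∈ (univ : Finset (DirichletCharacter ℂ f)).filter DirichletCharacter.IsPrimitive,
          ∑ ξ ∈ (univ : Finset (DirichletCharacter ℂ L'')).filter DirichletCharacter.IsPrimitive,
            Lsup L' (crtProd ψ ξ) H ≤
      ((Nat.totient L'' : ℝ) / (F * L'')) * lmvTerm L' H (f * L'') := by
    intro f hf
    rw [mem_filter, mem_Ioc] at hf
    obtain ⟨⟨hFf, hf2F⟩, hcop⟩ := hf
    have hf0 : 0 < f := lt_of_le_of_lt (Nat.zero_le F) hFf
    have hf0' : (0 : ℝ) < f := by exact_mod_cast hf0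
    have hφf : (0 : ℝ) < Nat.totient f := by exact_mod_cast Nat.totient_pos.2 hf0
    have hφmul : (Nat.totient (f * L'') : ℝ) = Nat.totient f * Nat.totient L'' := by
      rw [Nat.totient_mul hcop]; push_cast; ring
    have hS := sum_sum_crtProd_le_sum_primitive hf0 hL'' hcop (G := fun χ => Lsup L' χ H)
      (fun χ => Lsup_nonneg L' χ H)
    have hSnn : 0 ≤ ∑ χ ∈ (univ : Finset (DirichletCharacter ℂ (f * L''))).filter
        DirichletCharacter.IsPrimitive, Lsup L' χ H := sum_nonneg fun χ _ => Lsup_nonneg L' χ H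
    -- `φ(f)⁻¹ ≤ (φ(L'')/(F L'')) · (fL''/φ(fL''))`
    have hcoef : ((Nat.totient f : ℝ))⁻¹ ≤
        ((Nat.totient L'' : ℝ) / (F * L'')) * (((f * L'' : ℕ) : ℝ) / Nat.totient (f * L'')) := by
      rw [hφmul, Nat.cast_mul]
      rw [show ((Nat.totient L'' : ℝ) / (F * L'')) * ((f : ℝ) * L'' / (Nat.totient f * Nat.totient L'')) =
        ((f : ℝ) / F) * ((Nat.totient f : ℝ))⁻¹ by field_simp]
      have hfF : (1 : ℝ) ≤ (f : ℝ) / F := by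
        rw [le_div_iff₀ hF0, one_mul]; exact_mod_cast hFf.le
      calc ((Nat.totient f : ℝ))⁻¹ = 1 * ((Nat.totient f : ℝ))⁻¹ := (one_mul _).symm
        _ ≤ ((f : ℝ) / F) * ((Nat.totient f : ℝ))⁻¹ :=
            mul_le_mul_of_nonneg_right hfF (inv_nonneg.2 hφf.le)
    calc ((Nat.totient f : ℝ))⁻¹ *
          ∑ ψ ∈ (univ : Finset (DirichletCharacter ℂ f)).filter DirichletCharacter.IsPrimitive,
            ∑ ξ ∈ (univ : Finset (DirichletCharacter ℂ L'')).filter DirichletCharacter.IsPrimitive,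
              Lsup L' (crtProd ψ ξ) H
        ≤ ((Nat.totient f : ℝ))⁻¹ * ∑ χ ∈ (univ : Finset (DirichletCharacter ℂ (f * L''))).filter
            DirichletCharacter.IsPrimitive, Lsup L' χ H :=
          mul_le_mul_of_nonneg_left hS (inv_nonneg.2 hφf.le)
      _ ≤ (((Nat.totient L'' : ℝ) / (F * L'')) * (((f * L'' : ℕ) : ℝ) / Nat.totient (f * L''))) *
            ∑ χ ∈ (univ : Finset (DirichletCharacter ℂ (f * L''))).filter
              DirichletCharacter.IsPrimitive, Lsup L' χ H :=
          mul_le_mul_of_nonneg_right hcoef hSnn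
      _ = ((Nat.totient L'' : ℝ) / (F * L'')) * lmvTerm L' H (f * L'') := by
          rw [lmvTerm, mul_assoc]
  refine (sum_le_sum hterm).trans ?_
  rw [← mul_sum]
  refine mul_le_mul_of_nonneg_left ?_ (by positivity)
  -- `∑_{F < f ≤ F', (f,L'')=1} b(fL'') ≤ ∑_{k ≤ F'L''} b(k)` (injective `f ↦ fL''`, nonnegative terms)
  have hinj : Set.InjOn (fun f : ℕ => f * L'') ↑((Ioc F F').filter (fun f => f.Coprime L'')) := by
    intro f _ f' _ h
    exact Nat.eq_of_mul_eq_mul_right hL'' h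
  rw [← sum_image hinj]
  refine sum_le_sum_of_subset_of_nonneg ?_ fun k _ _ => lmvTerm_nonneg L' H k
  intro k hk
  rw [mem_image] at hk
  obtain ⟨f, hf, rfl⟩ := hk
  rw [mem_filter, mem_Ioc] at hf
  exact mem_Icc.2 ⟨Nat.mul_pos (lt_of_le_of_lt (Nat.zero_le F) hf.1.1) hL'',
    Nat.mul_le_mul_right L'' hf.1.2⟩

end Drappeau2017

end Literature.NumberTheory.Sieve

end
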